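import Summits.QuantumFields.YangMills.Theorems.TwistedTraceScaling.Negative.TraceRatioMonotone
import HarnessLib

/-!
# `TwistedTraceScaling` (crux stmt-QuantumFields-20203, route `LuscherReduction`, skeleton «twolattice» rev 2):
# negative-side support VII-b — CLOCK RIGIDITY: the femto trace law pins its clock; one-loop running is refuted mod FTL
# (refuter crux-disprover seat; this file does NOT refute the crux)

HONEST FRAMING: `TwistedTraceScaling` is a femto-rung (R2b1) crux of a CONDITIONAL reduction route; nothing here is a mass-gap or
Clay statement.  All objects are the tree's (`TraceDoor.traceRatio`, `TraceDoor.femtoSteps`, `TraceDoor.hTraceRatio`, `InFemtoWindow`,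
`luscherLambda`, `invRunningCoupling`, `b0`, `b1`); every law below is SPELLED OUT (no proposition is defined under `Summits/`, no
`Theses` import).  `FTL` denotes the femto trace law, VERBATIM the right-hand side of the tree equivalence
`Tower.twistedTraceScaling_iff_femtoTraceLaw` (`TwistedTraceScaling ↔ FTL`, file `…TwistedTraceScalingOfFemtoTraceLaw`, S-OSTL closed):
`∀ s>0 ∀ ε>0 ∃ lam0>0 ∀ lam∈(0,lam0] ∃ L0 ∀ L≥L0 ∀ β, InFemtoWindow lam β L → |r(L, β, ⌈sL/Λ(β,L)⌉) − r_𝔥(s)| ≤ ε`;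
so every `FTL → ¬X` below is `TwistedTraceScaling → ¬X` after one application of `Tower.femtoTraceLaw_of_twistedTraceScaling`.

WHY THIS FILE (design facts for the TOWER-E1 / RG lane).  The route owner's RG kit (2026-08-27, «RG-KIT-TOWER-E1» §1 F1/(c2)) and the
line lead's cycle report (S2) both assert, informally, that "the ONE matched number `1/ḡ²(β, L)` must be hit to RELATIVE `o(1)`;
one-loop running is insufficient".  This file makes the TRACE-currency content of that assertion a kernel-checked theorem, in the
strongest form the tree's objects allow (tools: `traceRatio_mono`, `hTraceRatio_lt_of_small`, `hTraceRatio_scale_rigid` of VII-a):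

* §3 ★ femto-window limits are UNIQUE (`femtoLimit_unique`: the window is inhabited at every depth on every lattice,
  `exists_inFemtoWindow`), hence a CONSTANT MISCLOCK is detected: if the law holds with target `r_𝔥(θ s)` at the crux's clock, or with
  target `r_𝔥(s)` at the clock `Λ/θ` (steps `⌈θ s L/Λ⌉ = femtoSteps (θ s)`), and FTL holds, then `θ = 1` (`misclock_eq_one`,
  `misclockSteps_eq_one`).
* §4 ★★ SLOW CLOCKS ARE REFUTED mod FTL (`not_traceLaw_of_slowClock`): no competitor step clock `T'(s, β, L)` that is eventually
  arbitrarily slower than the crux's (`∀ N, eventually ⌈sL/Λ⌉ ≤ T'(s/(N+1), β, L)` in the window) can carry the femto trace law — at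
  `T'(s/(N+1)) ≥ ⌈sL/Λ⌉` steps the ratio is `≥ r_𝔥(s) − ε` by monotonicity and FTL, but the competitor law says it is
  `≈ r_𝔥(s/(N+1)) → 0`.  INSTANCE (the point of the file): the one-parameter family of running labels
  `A_c(β, L) = β/2 − 2b₀ log L − c·log(β/(2b₀))`, clock `Λ_c = (max A_c 0)^{−1/3}`, steps `⌈sL/Λ_c⌉`; the crux's two-loop clock is the
  member `c = b₁/b₀` (`clockLambda_two_loop_eq : Λ_{b₁/b₀} = luscherLambda`), ONE-LOOP running is `c = 0`.  For every `c < b₁/b₀` the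
  `c`-clock is eventually arbitrarily slow in the two-loop window (`femtoSteps_le_clockSteps_eventually`: there `β > 4b₀ log L → ∞`,
  `four_b0_log_lt_beta_of_window`, so `A_c − 1/ḡ² = (b₁/b₀ − c) log(β/(2b₀)) → +∞` while `0 < 1/ḡ² ≤ 1/lam³`,
  `invRunningCoupling_le_of_window`), hence ★★ `not_clockTraceLaw_of_femtoTraceLaw : c < b₁/b₀ → FTL → ¬(femto trace law clocked by
  Λ_c)`, in particular `not_oneLoopTraceLaw_of_femtoTraceLaw` (`c = 0`).

READING FOR THE LANE.  (a) Any E1/RG mechanism whose control of the running coupling is only one-loop (or two-loop with a `log β`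
coefficient below `b₁/b₀`) proves, if anything, a law that FTL — hence the crux — REFUTES; the admissible error in `1/ḡ²` along the
window is `o(1)` ABSOLUTE at fixed `lam` (the matched number itself is `≍ lam⁻³`), i.e. relative `o(1)`, exactly the owner's (c2).
(b) The over-corrected side `c > b₁/b₀` is not a theorem here for an honest reason: there `A_c ≤ 0` eventually in the window,
`Λ_c = 0^{−1/3} = 0` and `⌈sL/0⌉ = 0` steps (Lean junk `x/0 = 0`), so the "law" degenerates to a statement about `r(L, β, 0)`, outside
`TraceFormula`'s range `T ≥ 2`.  (c) A constant misclock `Λ/θ` is NOT slow in the sense of §4 (fixed ratio); it is caught by §3 instead.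
-/

set_option autoImplicit false

noncomputable section

open MeasureTheory Filter Topology Real
open Literature.MathematicalPhysics.QuantumFieldTheory hiding SU2
open Literature.MathematicalPhysics.QuantumLattice
open Literature.Analysis.OperatorTheory.YMMatrixModel
open scoped BigOperators

namespace Summit.QuantumFields.YangMills.Theorems.TwistedTraceScaling.Negative

open Summit.QuantumFields.YangMills.Theorems.FemtoTransferGap
open Summit.QuantumFields.YangMills.Theorems.FemtoTransferGap.TraceDoor
open Summit.QuantumFields.YangMills.Theorems.FemtoTransferGap.TT
open Summit.QuantumFields.YangMills.Theorems.FemtoTransferGap.TwoLattice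

/-! ## §3 Femto-window limits are unique; a constant misclock is detected -/

/-- ★ **Femto-window limits are unique.**  If `g₁` and `g₂` are both femto-window limits of the dyadic trace ratio at the crux's clock
`T = ⌈sL/Λ⌉` (each in the crux's `∀ ε ∃ lam0 ∀ lam ∃ L0 ∀ L ∀ β ∈ window` sense), then `g₁ = g₂` on `s > 0`: the window is inhabited at
every depth `lam ≤ 1` on every lattice (`exists_inFemtoWindow`), so both estimates hold at a common point. [folklore] -/
theorem femtoLimit_unique {g₁ g₂ : ℝ → ℝ}
    (h₁ : ∀ s : ℝ, 0 < s → ∀ ε : ℝ, 0 < ε → ∃ lam0 : ℝ, 0 < lam0 ∧ ∀ lam : ℝ, 0 < lam → lam ≤ lam0 →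
      ∃ L0 : ℕ, ∀ (L : ℕ) [NeZero L], L0 ≤ L → ∀ β : ℝ, InFemtoWindow lam β L →
        |traceRatio L β (femtoSteps s β L) - g₁ s| ≤ ε)
    (h₂ : ∀ s : ℝ, 0 < s → ∀ ε : ℝ, 0 < ε → ∃ lam0 : ℝ, 0 < lam0 ∧ ∀ lam : ℝ, 0 < lam → lam ≤ lam0 →
      ∃ L0 : ℕ, ∀ (L : ℕ) [NeZero L], L0 ≤ L → ∀ β : ℝ, InFemtoWindow lam β L →
        |traceRatio L β (femtoSteps s β L) - g₂ s| ≤ ε)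
    {s : ℝ} (hs : 0 < s) : g₁ s = g₂ s := by
  by_contra hne
  have habs : 0 < |g₁ s - g₂ s| := abs_pos.mpr (sub_ne_zero.mpr hne)
  have hδ : 0 < |g₁ s - g₂ s| / 3 := by positivity
  obtain ⟨lam1, hlam1, H1⟩ := h₁ s hs _ hδ
  obtain ⟨lam2, hlam2, H2⟩ := h₂ s hs _ hδ
  obtain ⟨lam, hl0, hl1, hl2, hl⟩ : ∃ lam : ℝ, 0 < lam ∧ lam ≤ lam1 ∧ lam ≤ lam2 ∧ lam ≤ 1 :=
    ⟨min (min lam1 lam2) 1, lt_min (lt_min hlam1 hlam2) one_pos, (min_le_left _ _).trans (min_le_left _ _),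
      (min_le_left _ _).trans (min_le_right _ _), min_le_right _ _⟩
  obtain ⟨L1, HL1⟩ := H1 lam hl0 hl1
  obtain ⟨L2, HL2⟩ := H2 lam hl0 hl2
  obtain ⟨L, hL1, hL2, hL⟩ : ∃ L : ℕ, L1 ≤ L ∧ L2 ≤ L ∧ 1 ≤ L :=
    ⟨max (max L1 L2) 1, (le_max_left _ _).trans (le_max_left _ _), (le_max_right _ _).trans (le_max_left _ _),
      le_max_right _ _⟩
  haveI : NeZero L := ⟨by omega⟩
  obtain ⟨β, hW, -⟩ := exists_inFemtoWindow L hl0 hl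
  have e1 := HL1 L hL1 β hW
  have e2 := HL2 L hL2 β hW
  have h3 := abs_sub_le (g₁ s) (traceRatio L β (femtoSteps s β L)) (g₂ s)
  have h4 : |g₁ s - traceRatio L β (femtoSteps s β L)| = |traceRatio L β (femtoSteps s β L) - g₁ s| := abs_sub_comm _ _
  linarith

/-- ★ **A constant misclock of the target is detected**: if the femto trace law holds at the crux's clock with target `r_𝔥(θ·s)`
(`θ > 0`) and FTL (target `r_𝔥(s)`) holds too, then `θ = 1` (`femtoLimit_unique` + `hTraceRatio_scale_rigid`). [folklore] -/
theorem misclock_eq_one {θ : ℝ} (hθ : 0 < θ)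
    (hFTL : ∀ s : ℝ, 0 < s → ∀ ε : ℝ, 0 < ε → ∃ lam0 : ℝ, 0 < lam0 ∧ ∀ lam : ℝ, 0 < lam → lam ≤ lam0 →
      ∃ L0 : ℕ, ∀ (L : ℕ) [NeZero L], L0 ≤ L → ∀ β : ℝ, InFemtoWindow lam β L →
        |traceRatio L β (femtoSteps s β L) - hTraceRatio s| ≤ ε)
    (hθlaw : ∀ s : ℝ, 0 < s → ∀ ε : ℝ, 0 < ε → ∃ lam0 : ℝ, 0 < lam0 ∧ ∀ lam : ℝ, 0 < lam → lam ≤ lam0 →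
      ∃ L0 : ℕ, ∀ (L : ℕ) [NeZero L], L0 ≤ L → ∀ β : ℝ, InFemtoWindow lam β L →
        |traceRatio L β (femtoSteps s β L) - hTraceRatio (θ * s)| ≤ ε) :
    θ = 1 :=
  hTraceRatio_scale_rigid hθ fun _ hs =>
    femtoLimit_unique (g₁ := fun s => hTraceRatio (θ * s)) (g₂ := hTraceRatio) hθlaw hFTL hs

/-- ★ **A constant misclock of the steps is detected**: if the femto trace law holds with target `r_𝔥(s)` at the clock `Λ/θ`, i.e. at
`T = ⌈θ s L/Λ⌉ = femtoSteps (θ s) β L` steps (`θ > 0`), and FTL holds too, then `θ = 1`. [folklore] -/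
theorem misclockSteps_eq_one {θ : ℝ} (hθ : 0 < θ)
    (hFTL : ∀ s : ℝ, 0 < s → ∀ ε : ℝ, 0 < ε → ∃ lam0 : ℝ, 0 < lam0 ∧ ∀ lam : ℝ, 0 < lam → lam ≤ lam0 →
      ∃ L0 : ℕ, ∀ (L : ℕ) [NeZero L], L0 ≤ L → ∀ β : ℝ, InFemtoWindow lam β L →
        |traceRatio L β (femtoSteps s β L) - hTraceRatio s| ≤ ε)
    (hθlaw : ∀ s : ℝ, 0 < s → ∀ ε : ℝ, 0 < ε → ∃ lam0 : ℝ, 0 < lam0 ∧ ∀ lam : ℝ, 0 < lam → lam ≤ lam0 →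
      ∃ L0 : ℕ, ∀ (L : ℕ) [NeZero L], L0 ≤ L → ∀ β : ℝ, InFemtoWindow lam β L →
        |traceRatio L β (femtoSteps (θ * s) β L) - hTraceRatio s| ≤ ε) :
    θ = 1 := by
  have hlaw' : ∀ u : ℝ, 0 < u → ∀ ε : ℝ, 0 < ε → ∃ lam0 : ℝ, 0 < lam0 ∧ ∀ lam : ℝ, 0 < lam → lam ≤ lam0 →
      ∃ L0 : ℕ, ∀ (L : ℕ) [NeZero L], L0 ≤ L → ∀ β : ℝ, InFemtoWindow lam β L →
        |traceRatio L β (femtoSteps u β L) - hTraceRatio (θ⁻¹ * u)| ≤ ε := by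
    intro u hu
    have h := hθlaw (θ⁻¹ * u) (by positivity)
    rwa [← mul_assoc, mul_inv_cancel₀ hθ.ne', one_mul] at h
  have hinv : θ⁻¹ = 1 := misclock_eq_one (inv_pos.mpr hθ) hFTL hlaw'
  rw [← inv_inv θ, hinv, inv_one]

/-! ## §4 Slow clocks are refuted mod FTL; the running-label family `A_c = β/2 − 2b₀ log L − c log(β/(2b₀))` -/

/-- ★★ **No slow competitor clock carries the femto trace law (mod FTL).**  If a step clock `T'(s, β, L)` is eventually arbitrarily
slower than the crux's — for every `N`, every `s > 0`, every depth `lam ∈ (0,1]`, eventually in `L`, throughout the window,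
`⌈sL/Λ⌉ ≤ T'(s/(N+1), β, L)` — then the law `r(L, β, T'(s, β, L)) → r_𝔥(s)` fails: at `T'(s/(N+1)) ≥ ⌈sL/Λ⌉` steps the ratio is
`≥ r_𝔥(s) − ε > 0` (FTL and the monotonicity `traceRatio_mono`), while the competitor law makes it `≤ r_𝔥(s/(N+1)) + ε → ε` (§1). [folklore] -/
theorem not_traceLaw_of_slowClock
    (hFTL : ∀ s : ℝ, 0 < s → ∀ ε : ℝ, 0 < ε → ∃ lam0 : ℝ, 0 < lam0 ∧ ∀ lam : ℝ, 0 < lam → lam ≤ lam0 →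
      ∃ L0 : ℕ, ∀ (L : ℕ) [NeZero L], L0 ≤ L → ∀ β : ℝ, InFemtoWindow lam β L →
        |traceRatio L β (femtoSteps s β L) - hTraceRatio s| ≤ ε)
    {T' : ℝ → ℝ → ℕ → ℕ}
    (hslow : ∀ (N : ℕ) (s : ℝ), 0 < s → ∀ lam : ℝ, 0 < lam → lam ≤ 1 → ∃ L1 : ℕ, ∀ (L : ℕ) [NeZero L], L1 ≤ L →
      ∀ β : ℝ, InFemtoWindow lam β L → femtoSteps s β L ≤ T' (s / (N + 1)) β L) :
    ¬ (∀ s : ℝ, 0 < s → ∀ ε : ℝ, 0 < ε → ∃ lam0 : ℝ, 0 < lam0 ∧ ∀ lam : ℝ, 0 < lam → lam ≤ lam0 →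
        ∃ L0 : ℕ, ∀ (L : ℕ) [NeZero L], L0 ≤ L → ∀ β : ℝ, InFemtoWindow lam β L →
          |traceRatio L β (T' s β L) - hTraceRatio s| ≤ ε) := by
  intro hT'
  have hr1 : 0 < hTraceRatio 1 := hTraceRatio_pos one_pos
  obtain ⟨s₀, hs₀, hsmall⟩ := hTraceRatio_lt_of_small (c := hTraceRatio 1 / 3) (by positivity)
  obtain ⟨N, hN⟩ : ∃ N : ℕ, 1 / s₀ < (N : ℝ) + 1 := ⟨⌈1 / s₀⌉₊, (Nat.le_ceil _).trans_lt (lt_add_one _)⟩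
  have hsN : 0 < 1 / ((N : ℝ) + 1) := by positivity
  have hN1 : 1 / ((N : ℝ) + 1) ≤ s₀ := by
    rw [div_lt_iff₀ hs₀] at hN
    rw [div_le_iff₀ (by positivity : (0 : ℝ) < N + 1)]
    linarith
  have hε0 : 0 < hTraceRatio 1 / 3 := by positivity
  obtain ⟨lamF, hlamF, HF⟩ := hFTL 1 one_pos _ hε0
  obtain ⟨lamC, hlamC, HC⟩ := hT' (1 / ((N : ℝ) + 1)) hsN _ hε0
  obtain ⟨lam, hl0, hlF, hlC, hl1⟩ : ∃ lam : ℝ, 0 < lam ∧ lam ≤ lamF ∧ lam ≤ lamC ∧ lam ≤ 1 :=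
    ⟨min (min lamF lamC) 1, lt_min (lt_min hlamF hlamC) one_pos, (min_le_left _ _).trans (min_le_left _ _),
      (min_le_left _ _).trans (min_le_right _ _), min_le_right _ _⟩
  obtain ⟨LF, HLF⟩ := HF lam hl0 hlF
  obtain ⟨LC, HLC⟩ := HC lam hl0 hlC
  obtain ⟨L1, HL1⟩ := hslow N 1 one_pos lam hl0 hl1
  obtain ⟨L, hLF, hLC, hL1, hL2⟩ : ∃ L : ℕ, LF ≤ L ∧ LC ≤ L ∧ L1 ≤ L ∧ 2 ≤ L :=
    ⟨max (max LF LC) (max L1 2), (le_max_left _ _).trans (le_max_left _ _), (le_max_right _ _).trans (le_max_left _ _),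
      (le_max_left _ _).trans (le_max_right _ _), (le_max_right _ _).trans (le_max_right _ _)⟩
  haveI : NeZero L := ⟨by omega⟩
  obtain ⟨β, hW, hΛ⟩ := exists_inFemtoWindow L hl0 hl1
  have eF := HLF L hLF β hW
  have eC := HLC L hLC β hW
  have hle : femtoSteps 1 β L ≤ T' (1 / ((N : ℝ) + 1)) β L := HL1 L hL1 β hW
  have hL2r : (2 : ℝ) ≤ L := by exact_mod_cast hL2
  have hTf2 : 2 ≤ femtoSteps 1 β L := by
    have h1 : 1 < femtoSteps 1 β L := by
      unfold femtoSteps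
      refine Nat.lt_ceil.mpr ?_
      rw [Nat.cast_one, hΛ, lt_div_iff₀ hl0]
      linarith
    omega
  have hmono := traceRatio_mono L hW.1 hTf2 hle
  have hsm := hsmall (1 / ((N : ℝ) + 1)) hsN hN1
  have h1 := (abs_le.mp eF).1
  have h2 := (abs_le.mp eC).2
  linarith

/-- `((max a 0)^{−1/3})³ = a⁻¹` for `a > 0` (the cube of a clock is the inverse of its label). [folklore] -/
theorem max_rpow_neg_third_pow_three {a : ℝ} (ha : 0 < a) : ((max a 0) ^ (-(1 : ℝ) / 3)) ^ 3 = a⁻¹ := by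
  rw [max_eq_left ha.le, ← Real.rpow_natCast, ← Real.rpow_mul ha.le]
  norm_num
  exact Real.rpow_neg_one a

/-- `0 < (max a 0)^{−1/3}` for `a > 0`. [folklore] -/
theorem max_rpow_neg_third_pos {a : ℝ} (ha : 0 < a) : 0 < (max a 0) ^ (-(1 : ℝ) / 3) := by
  rw [max_eq_left ha.le]
  exact Real.rpow_pos_of_pos ha _

/-- **The crux's clock is the member `c = b₁/b₀` of the family** `Λ_c = (max (β/2 − 2b₀ log L − c log(β/(2b₀))) 0)^{−1/3}`:
`Λ_{b₁/b₀}(β, L) = luscherLambda β L` for `β > 0` (`invRunningCoupling_eq`). [cite: LuscherMunster1984, §2] -/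
theorem clockLambda_two_loop_eq {β : ℝ} (hβ : 0 < β) (L : ℕ) :
    (max (β / 2 - 2 * b0 * Real.log L - (b1 / b0) * Real.log (β / (2 * b0))) 0) ^ (-(1 : ℝ) / 3) = luscherLambda β L := by
  have hb0 : 0 < b0 := by unfold b0; positivity
  unfold luscherLambda
  congr 2
  rw [BOHandover.invRunningCoupling_eq, Real.log_div hβ.ne' (by positivity), Real.log_div (by positivity) hβ.ne']
  ring

/-- In the window the label is squeezed: `0 < 1/ḡ²(β, L) ≤ 1/lam³` (`lam ≤ Λ`, `Λ³ = ḡ²`). [folklore] -/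
theorem invRunningCoupling_le_of_window {lam β : ℝ} {L : ℕ} (hlam : 0 < lam) (hW : InFemtoWindow lam β L) :
    0 < invRunningCoupling β L ∧ invRunningCoupling β L ≤ 1 / lam ^ 3 := by
  have hl : 0 < luscherLambda β L := luscherLambda_pos_of_window hlam hW
  have hv : 0 < invRunningCoupling β L := BOHandover.invRunningCoupling_pos_of_luscherLambda_pos hl
  refine ⟨hv, ?_⟩
  have h3 : lam ^ 3 ≤ luscherLambda β L ^ 3 := pow_le_pow_left₀ hlam.le hW.2.1 3
  rw [BOHandover.luscherLambda_pow_three hv] at h3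
  rw [le_div_iff₀ (by positivity), ← le_div_iff₀' hv, div_eq_inv_mul, mul_one]
  exact h3

/-- **In the window the bare coupling outgrows the lattice**: `4b₀ log L < β` (`0 < 1/ḡ² = β/2 − 2b₀ log L + (b₁/b₀) log(2b₀/β)`
and the last term is `≤ 0` for `β ≥ 1 ≥ 2b₀`). [folklore] -/
theorem four_b0_log_lt_beta_of_window {lam β : ℝ} {L : ℕ} [NeZero L] (hlam : 0 < lam) (hW : InFemtoWindow lam β L) :
    4 * b0 * Real.log L < β := by
  have hv := (invRunningCoupling_le_of_window hlam hW).1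
  have hβ1 : 1 ≤ β := hW.1
  have hb0 : 0 < b0 := by unfold b0; positivity
  have hb1 : 0 < b1 := by unfold b1; positivity
  rw [BOHandover.invRunningCoupling_eq] at hv
  have hlog : Real.log (2 * b0 / β) ≤ 0 := by
    apply Real.log_nonpos (by positivity)
    rw [div_le_one (by linarith)]
    exact BOHandover.two_mul_b0_le_one.trans hβ1
  have h2 : (b1 / b0) * Real.log (2 * b0 / β) ≤ 0 := mul_nonpos_of_nonneg_of_nonpos (div_pos hb1 hb0).le hlog
  linarith

/-- **Eventually in the window `log(β/(2b₀))` exceeds any bound** (from `β > 4b₀ log L`). [folklore] -/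
theorem log_beta_large_eventually (M : ℝ) {lam : ℝ} (hlam : 0 < lam) :
    ∃ L1 : ℕ, ∀ (L : ℕ) [NeZero L], L1 ≤ L → ∀ β : ℝ, InFemtoWindow lam β L → M < Real.log (β / (2 * b0)) := by
  have hb0 : 0 < b0 := by unfold b0; positivity
  refine ⟨⌈Real.exp (Real.exp M / 2)⌉₊, fun L _ hL β hW => ?_⟩
  have hβ := four_b0_log_lt_beta_of_window hlam hW
  have hL1 : Real.exp (Real.exp M / 2) ≤ (L : ℝ) := (Nat.le_ceil _).trans (by exact_mod_cast hL)
  have hlogL : Real.exp M / 2 ≤ Real.log (L : ℝ) := by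
    rw [Real.le_log_iff_exp_le (lt_of_lt_of_le (Real.exp_pos _) hL1)]
    exact hL1
  rw [Real.lt_log_iff_exp_lt (div_pos (by linarith [hW.1]) (by positivity)), lt_div_iff₀ (by positivity)]
  nlinarith

/-- ★ **Every under-corrected clock is eventually arbitrarily slow in the two-loop window.**  For `c < b₁/b₀`, every `N`, `s ≥ 0` and
depth `lam > 0`: eventually in `L`, throughout the window, `⌈sL/Λ⌉ ≤ ⌈(s/(N+1)) L/Λ_c⌉` with
`Λ_c = (max (β/2 − 2b₀ log L − c log(β/(2b₀))) 0)^{−1/3}` — because `A_c = 1/ḡ² + (b₁/b₀ − c) log(β/(2b₀)) ≥ (N+1)³/ḡ²` once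
`(b₁/b₀ − c) log(β/(2b₀)) ≥ (N+1)³/lam³ ≥ (N+1)³·(1/ḡ²)`, i.e. `Λ_c ≤ Λ/(N+1)`. [folklore] -/
theorem femtoSteps_le_clockSteps_eventually {c : ℝ} (hc : c < b1 / b0) (N : ℕ) {s : ℝ} (hs : 0 ≤ s) {lam : ℝ} (hlam : 0 < lam) :
    ∃ L1 : ℕ, ∀ (L : ℕ) [NeZero L], L1 ≤ L → ∀ β : ℝ, InFemtoWindow lam β L →
      femtoSteps s β L ≤ ⌈s / (N + 1) * L / (max (β / 2 - 2 * b0 * Real.log L - c * Real.log (β / (2 * b0))) 0) ^ (-(1 : ℝ) / 3)⌉₊ := by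
  have hb0 : 0 < b0 := by unfold b0; positivity
  have hκ : 0 < b1 / b0 - c := by linarith
  obtain ⟨L1, HL1⟩ := log_beta_large_eventually (((N : ℝ) + 1) ^ 3 / ((b1 / b0 - c) * lam ^ 3)) hlam
  refine ⟨L1, fun L _ hL β hW => ?_⟩
  have hM := HL1 L hL β hW
  obtain ⟨hv, hvle⟩ := invRunningCoupling_le_of_window hlam hW
  have hl : 0 < luscherLambda β L := luscherLambda_pos_of_window hlam hW
  have hβ0 : 0 < β := by linarith [hW.1]
  -- the `c`-label in terms of the two-loop label
  set A := β / 2 - 2 * b0 * Real.log L - c * Real.log (β / (2 * b0)) with hAdef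
  have hA : A = invRunningCoupling β L + (b1 / b0 - c) * Real.log (β / (2 * b0)) := by
    rw [hAdef, BOHandover.invRunningCoupling_eq, Real.log_div hβ0.ne' (by positivity), Real.log_div (by positivity) hβ0.ne']
    ring
  -- `(b₁/b₀ − c) log(β/(2b₀)) ≥ (N+1)³/lam³ ≥ (N+1)³ · (1/ḡ²)`
  have hlog : ((N : ℝ) + 1) ^ 3 / lam ^ 3 ≤ (b1 / b0 - c) * Real.log (β / (2 * b0)) := by
    have := (div_lt_iff₀ (by positivity : 0 < (b1 / b0 - c) * lam ^ 3)).mp hM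
    rw [div_le_iff₀ (by positivity)]
    nlinarith
  have hNv : ((N : ℝ) + 1) ^ 3 * invRunningCoupling β L ≤ ((N : ℝ) + 1) ^ 3 / lam ^ 3 := by
    rw [← mul_one_div]
    exact mul_le_mul_of_nonneg_left hvle (by positivity)
  have hAge : ((N : ℝ) + 1) ^ 3 * invRunningCoupling β L ≤ A := by rw [hA]; nlinarith
  have hNv0 : 0 < ((N : ℝ) + 1) ^ 3 * invRunningCoupling β L := by positivity
  have hA0 : 0 < A := lt_of_lt_of_le hNv0 hAge
  -- compare the clocks through their cubes
  have hc0 : 0 < (max A 0) ^ (-(1 : ℝ) / 3) := max_rpow_neg_third_pos hA0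
  have hcube : ((max A 0) ^ (-(1 : ℝ) / 3)) ^ 3 ≤ (luscherLambda β L / (N + 1)) ^ 3 := by
    rw [max_rpow_neg_third_pow_three hA0, div_pow, BOHandover.luscherLambda_pow_three hv, ← inv_div, inv_div,
      div_eq_mul_inv, ← mul_inv, mul_comm]
    exact inv_anti₀ hNv0 hAge
  have hclock : (max A 0) ^ (-(1 : ℝ) / 3) ≤ luscherLambda β L / (N + 1) :=
    le_of_pow_le_pow_left₀ (by norm_num) (by positivity) hcube
  -- hence the step counts compare
  unfold femtoSteps
  apply Nat.ceil_mono
  have hNc : 0 < ((N : ℝ) + 1) * (max A 0) ^ (-(1 : ℝ) / 3) := by positivity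
  have hNcle : ((N : ℝ) + 1) * (max A 0) ^ (-(1 : ℝ) / 3) ≤ luscherLambda β L := by
    rwa [le_div_iff₀' (by positivity)] at hclock
  calc s * L / luscherLambda β L ≤ s * L / (((N : ℝ) + 1) * (max A 0) ^ (-(1 : ℝ) / 3)) :=
        div_le_div_of_nonneg_left (by positivity) hNc hNcle
    _ = s / (N + 1) * L / (max A 0) ^ (-(1 : ℝ) / 3) := by
        field_simp

/-- ★★ **Every under-corrected running clock is refuted mod FTL** — in particular ONE-LOOP running (`c = 0`).  For `c < b₁/b₀` the femto
trace law clocked by `Λ_c = (max (β/2 − 2b₀ log L − c log(β/(2b₀))) 0)^{−1/3}` (steps `⌈sL/Λ_c⌉`, window unchanged) contradicts FTL;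
the crux's own clock is `c = b₁/b₀` (`clockLambda_two_loop_eq`). [folklore] -/
theorem not_clockTraceLaw_of_femtoTraceLaw {c : ℝ} (hc : c < b1 / b0)
    (hFTL : ∀ s : ℝ, 0 < s → ∀ ε : ℝ, 0 < ε → ∃ lam0 : ℝ, 0 < lam0 ∧ ∀ lam : ℝ, 0 < lam → lam ≤ lam0 →
      ∃ L0 : ℕ, ∀ (L : ℕ) [NeZero L], L0 ≤ L → ∀ β : ℝ, InFemtoWindow lam β L →
        |traceRatio L β (femtoSteps s β L) - hTraceRatio s| ≤ ε) :
    ¬ (∀ s : ℝ, 0 < s → ∀ ε : ℝ, 0 < ε → ∃ lam0 : ℝ, 0 < lam0 ∧ ∀ lam : ℝ, 0 < lam → lam ≤ lam0 →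
        ∃ L0 : ℕ, ∀ (L : ℕ) [NeZero L], L0 ≤ L → ∀ β : ℝ, InFemtoWindow lam β L →
          |traceRatio L β ⌈s * L / (max (β / 2 - 2 * b0 * Real.log L - c * Real.log (β / (2 * b0))) 0) ^ (-(1 : ℝ) / 3)⌉₊ -
            hTraceRatio s| ≤ ε) :=
  not_traceLaw_of_slowClock hFTL
    (T' := fun s β L => ⌈s * L / (max (β / 2 - 2 * b0 * Real.log L - c * Real.log (β / (2 * b0))) 0) ^ (-(1 : ℝ) / 3)⌉₊)
    fun N _ hs _ hlam _ => femtoSteps_le_clockSteps_eventually hc N hs.le hlam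

/-- ★★ **One-loop running is refuted mod FTL**: the femto trace law clocked by the ONE-LOOP label `β/2 − 2b₀ log L`
(`Λ₁ = (max (β/2 − 2b₀ log L) 0)^{−1/3}`, steps `⌈sL/Λ₁⌉`) contradicts FTL. [folklore] -/
theorem not_oneLoopTraceLaw_of_femtoTraceLaw
    (hFTL : ∀ s : ℝ, 0 < s → ∀ ε : ℝ, 0 < ε → ∃ lam0 : ℝ, 0 < lam0 ∧ ∀ lam : ℝ, 0 < lam → lam ≤ lam0 →
      ∃ L0 : ℕ, ∀ (L : ℕ) [NeZero L], L0 ≤ L → ∀ β : ℝ, InFemtoWindow lam β L →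
        |traceRatio L β (femtoSteps s β L) - hTraceRatio s| ≤ ε) :
    ¬ (∀ s : ℝ, 0 < s → ∀ ε : ℝ, 0 < ε → ∃ lam0 : ℝ, 0 < lam0 ∧ ∀ lam : ℝ, 0 < lam → lam ≤ lam0 →
        ∃ L0 : ℕ, ∀ (L : ℕ) [NeZero L], L0 ≤ L → ∀ β : ℝ, InFemtoWindow lam β L →
          |traceRatio L β ⌈s * L / (max (β / 2 - 2 * b0 * Real.log L) 0) ^ (-(1 : ℝ) / 3)⌉₊ - hTraceRatio s| ≤ ε) := by
  have hb : (0 : ℝ) < b1 / b0 := div_pos (by unfold b1; positivity) (by unfold b0; positivity)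
  simpa only [zero_mul, sub_zero] using not_clockTraceLaw_of_femtoTraceLaw hb hFTL

end Summit.QuantumFields.YangMills.Theorems.TwistedTraceScaling.Negative

end
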